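import Summits.QuantumFields.YangMills.Theorems.BalabanUVNodesN22KnitFiniteTower

/-!
# BalabanUVNodes ∕ N22 knit, LINEAR LETTER — node N22 = NE9 ∧ FadingMemory BY NAME from (P) + (O) (node N18's tower rate `θ`) + a
# second-difference letter growing LINEARLY in the age (the shape the (2.13) body delivers, `BalabanUVNodesN22KnitBodyTower` §3), for EVERY
# fading rate `τ ∈ (√θ, 1]`: on ROAD 2 the E-side carries no smallness condition (Track A, DAG node N22; cluster K4 «SpineRates»; seat
# `pub-ymgap-dag-n22-a`)

HONEST FRAMING.  Count-neutral kernel bookkeeping over hypothesis shapes on the ABSTRACT carriers `T4OutputRate.Carriers` and ne9's tower of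
carriers; NOT a node discharge; NE5 ∕ NE9 NOT IN PRINT, NOT PROVED; instance on Bałaban's localized `E^{(j)}(X)` 0∕1 (wall W1 = the
localization of the body tower, unchanged); one finite four-torus programme at fixed ε; nothing continuum ∕ ℝ⁴ ∕ OS ∕ mass-gap ∕ Clay.
0 `sorry`, 0 `def`, standard axioms.  `--supports` item `SpineGivenEndpoint` (route «BalabanUVNodes», cluster K4).

THE POINT.  `BalabanUVNodesN22KnitDiscrete.ne9_and_fadingMemory_of_osc_secondDiff` closes node N22 from (P) + (O) (rate `θ`) + (R₂) with
GEOMETRIC growth `μ^{age}` whenever `θμ ≤ τ²` — fading (`τ < 1`) iff `θμ < 1`.  The companion body file `BalabanUVNodesN22KnitBodyTower`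
(`abs_secondDiff_action_le_linear`) shows that the (2.13) body's second differences in an older coupling grow only LINEARLY in the age,
`(ℓ₂ + 2L₁²·age)·d²`, with no smallness.  A linear profile lies under `ν^{age}` for EVERY `ν > 1` (§1, Bernoulli), hence:
* §2 `ne9_and_fadingMemory_of_osc_linearSecondDiff` — (P) + (O) + (R₂-lin) `≤ (ℓ + m·(scale X − 1 − i))·e^{−κd(X)}·d²` ⟹
  **`NE9 E (Window γ) κ Λ₁ ∧ FadingMemory C₉ τ Λ₁`**, `Λ₁ k i = C₉·τ^{k−i}`, `C₉ = (4C₀∕γ + (ℓ + m∕(ν−1))·γ∕2)∕τ`, for every `ν > 1` and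
  `τ ∈ ]0, 1]` with `θν ≤ τ²`; `ne9_and_fadingMemory_of_osc_linearSecondDiff_of_lt` — the same stated for EVERY `τ ∈ ]0, 1]` with `θ < τ²`
  (the choice `ν = 1 + (τ² − θ)∕(τ² + θ)`, `C₉ = (4C₀∕γ + (ℓ + m·(τ² + θ)∕(τ² − θ))·γ∕2)∕τ`): node N22's statement of record BY NAME with
  NO E-side smallness — only `θ < 1` (node N18) is spent, versus ROAD 1's clause N2 `ω′ < 1` and `N22KnitRecursion`'s `ω + c < θ^{−1∕2}`.
* §3 `ne9_fadingMemory_at_level_of_ne5_below_linear` — along ne9's tower of carriers with node N18 BY NAME at the run lengths below the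
  level (`N22KnitFiniteTower.oscFading_of_ne5_below`).
RESIDUAL PROPER TO N22 ON ROAD 2 (said plainly): (O) = node N18 (in-edge); the LOCALIZATION of the body tower into the letter (R₂-lin) — the
object W1 ([Balaban1988RG2Cluster] §§1–2); and the body tower's own displayed binders, notably ONE first-order letter for the accumulated old
action along the bracket's coupling curve UNIFORM in the step (ref-B READ-207 A4: the linear regime is conditional on it).

References (TYPES only): [Balaban1987RG1] = T. Bałaban, Commun. Math. Phys. **109** (1987) 249–301 — p. 256, Thm 1 p. 259, (1.18) and the
C^∞ clause p. 263, (2.13) p. 268, p. 298; [Balaban1988RG2Cluster] = T. Bałaban, Commun. Math. Phys. **116** (1988) 1–22 — §§1–2.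
-/

noncomputable section

namespace Summit.QuantumFields.YangMills.BalabanUVNodes.N22KnitLinear

open Set
open scoped BigOperators
open Literature.MathematicalPhysics.QuantumFieldTheory.Balaban1983to89

/-! ## §1 The geometric envelope of a linear profile -/

/-- Bernoulli: a LINEARLY growing profile lies under a GEOMETRIC one at every rate `ν > 1`: `ℓ + m·n ≤ (ℓ + m∕(ν − 1))·ν^{n}` (`ℓ, m ≥ 0`).
So the body tower's letter (`BalabanUVNodesN22KnitBodyTower` §3) has the (R₂) shape of `BalabanUVNodesN22KnitDiscrete` with growth `ν`, for EVERY `ν > 1`. [folklore] -/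
theorem linear_le_geometric {ℓ m ν : ℝ} (hℓ : 0 ≤ ℓ) (hm : 0 ≤ m) (hν : 1 < ν) (n : ℕ) :
    ℓ + m * n ≤ (ℓ + m / (ν - 1)) * ν ^ n := by
  have hν1 : 0 < ν - 1 := by linarith
  have hB : 1 + (n : ℝ) * (ν - 1) ≤ ν ^ n := by
    have h := one_add_mul_le_pow (a := ν - 1) (by linarith) n
    rwa [show 1 + (ν - 1) = ν by ring] at h
  have hpow1 : 1 ≤ ν ^ n := one_le_pow₀ hν.le
  have h1 : ℓ ≤ ℓ * ν ^ n := le_mul_of_one_le_right hℓ hpow1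
  have h2 : m * n ≤ m / (ν - 1) * ν ^ n := by
    rw [div_mul_eq_mul_div, le_div_iff₀ hν1]
    have : (n : ℝ) * (ν - 1) ≤ ν ^ n := by linarith
    calc m * n * (ν - 1) = m * ((n : ℝ) * (ν - 1)) := by ring
      _ ≤ m * ν ^ n := mul_le_mul_of_nonneg_left this hm
  calc ℓ + m * n ≤ ℓ * ν ^ n + m / (ν - 1) * ν ^ n := add_le_add h1 h2
    _ = (ℓ + m / (ν - 1)) * ν ^ n := by ring

/-! ## §2 On the abstract carriers: node N22 from (P) + (O) + a LINEARLY growing second-difference letter -/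

section Abstract

open Literature.MathematicalPhysics.QuantumFieldTheory.Balaban1983to89.T4OutputRate
open Summit.QuantumFields.YangMills.BalabanUVNodes.N22KnitDiscrete (ne9_and_fadingMemory_of_osc_secondDiff)
open Summit.QuantumFields.YangMills.BalabanUVNodes.N22KnitFiniteTower (ne9_fadingMemory_at_level_of_ne5_below)
open Summit.QuantumFields.BalabanUV.T4Continuum.NE9.TowerCarriers (TowerData prepend)

variable {C : Carriers} {Bg : Type} {E : Functional C Bg}

/-- **NODE N22 FROM (P) + (O) + THE LINEAR LETTER — EVERY FADING RATE ABOVE `√θ`.**  On the abstract output carriers: (P) prefix dependence;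
(O) oscillation fading with constant `C₀ ≥ 0` and rate `θ ≥ 0` (= node N18 along the tower); (R₂-lin) second differences of every
young-coupling section on `]0, γ]` bounded by `(ℓ + m·(scale X − 1 − i))·e^{−κd(X)}·d²` (`ℓ, m ≥ 0`; the shape `BalabanUVNodesN22KnitBodyTower` §3 gives
the body, once localized).  Then for EVERY `ν > 1` and every `τ ∈ ]0, 1]` with `θν ≤ τ²`: **`NE9 E (Window γ) κ Λ₁ ∧ FadingMemory C₉ τ Λ₁`**,
`Λ₁ k i = C₉·τ^{k−i}`, `C₉ = (4C₀∕γ + (ℓ + m∕(ν−1))·γ∕2)∕τ` — node N22's statement of record BY NAME (`N22KnitDiscrete` with `μ = ν`,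
`ρ = τ∕ν`).  Since `ν` may be taken as close to `1` as desired, every fading rate `τ > √θ` is available: NO E-side smallness. [folklore] -/
theorem ne9_and_fadingMemory_of_osc_linearSecondDiff {γ κ C₀ θ ℓ m ν τ : ℝ} (hP : PrefixDependenceOn E (Window γ))
    (hO : ∀ g ∈ Window γ, ∀ g' ∈ Window γ, ∀ (U : Bg) (X : C.Dom) (a : ℕ), a ≤ C.scale X →
      (∀ n, a ≤ n → g n = g' n) → |E g U X - E g' U X| ≤ C₀ * θ ^ (C.scale X - a) * Real.exp (-(κ * C.d X)))
    (hR2 : ∀ g ∈ Window γ, ∀ (U : Bg) (X : C.Dom) (i : ℕ), i < C.scale X → ∀ t d : ℝ, 0 < d →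
      t - d ∈ Ioc (0 : ℝ) γ → t + d ∈ Ioc (0 : ℝ) γ →
        |E (Function.update g i (t + d)) U X - 2 * E (Function.update g i t) U X + E (Function.update g i (t - d)) U X| ≤
          (ℓ + m * ((C.scale X - 1 - i : ℕ) : ℝ)) * Real.exp (-(κ * C.d X)) * d ^ 2)
    (hC₀ : 0 ≤ C₀) (hθ0 : 0 ≤ θ) (hℓ : 0 ≤ ℓ) (hm : 0 ≤ m) (hγ : 0 < γ) (hν : 1 < ν) (hθν : θ * ν ≤ τ ^ 2)
    (hτ0 : 0 < τ) (hτ1 : τ ≤ 1) :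
    NE9 E (Window γ) κ (fun k i => (4 * C₀ / γ + (ℓ + m / (ν - 1)) * γ / 2) / τ * τ ^ (k - i)) ∧
      FadingMemory ((4 * C₀ / γ + (ℓ + m / (ν - 1)) * γ / 2) / τ) τ
        (fun k i => (4 * C₀ / γ + (ℓ + m / (ν - 1)) * γ / 2) / τ * τ ^ (k - i)) := by
  have hν0 : 0 < ν := by linarith
  have hM : 0 ≤ ℓ + m / (ν - 1) := add_nonneg hℓ (div_nonneg hm (by linarith))
  -- the linear letter under its geometric envelope
  have hR2' : ∀ g ∈ Window γ, ∀ (U : Bg) (X : C.Dom) (i : ℕ), i < C.scale X → ∀ t d : ℝ, 0 < d →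
      t - d ∈ Ioc (0 : ℝ) γ → t + d ∈ Ioc (0 : ℝ) γ →
        |E (Function.update g i (t + d)) U X - 2 * E (Function.update g i t) U X + E (Function.update g i (t - d)) U X| ≤
          (ℓ + m / (ν - 1)) * ν ^ (C.scale X - 1 - i) * Real.exp (-(κ * C.d X)) * d ^ 2 := by
    intro g hg U X i hi t d hd h1 h2
    refine (hR2 g hg U X i hi t d hd h1 h2).trans ?_
    have h := linear_le_geometric hℓ hm hν (C.scale X - 1 - i)
    have hw : 0 ≤ Real.exp (-(κ * C.d X)) * d ^ 2 := by positivity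
    nlinarith
  -- step ratio `ρ = τ/ν`
  have hρ0 : 0 < τ / ν := div_pos hτ0 hν0
  have hρ1 : τ / ν ≤ 1 := by rw [div_le_one hν0]; linarith
  have hθτρ : θ ≤ τ * (τ / ν) := by
    rw [mul_div_assoc', le_div_iff₀ hν0, ← sq]; exact hθν
  have hμρτ : ν * (τ / ν) ≤ τ := by rw [mul_div_cancel₀ τ hν0.ne']
  exact ne9_and_fadingMemory_of_osc_secondDiff (μ := ν) hP hO hR2' hC₀ hθ0 hM hν0.le hγ hρ0 hρ1 hθτρ hμρτ hτ0

/-- **NODE N22 FOR EVERY FADING RATE `τ ∈ (√θ, 1]`.**  §2's headline with the growth rate chosen for you: under (P), (O) (constant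
`C₀ ≥ 0`, rate `θ ≥ 0`) and the linear letter (R₂-lin), for every `τ ∈ ]0, 1]` with `θ < τ²`: **`NE9 E (Window γ) κ Λ₁ ∧ FadingMemory C₉ τ Λ₁`**,
`Λ₁ k i = C₉·τ^{k−i}`, `C₉ = (4C₀∕γ + (ℓ + m·(τ² + θ)∕(τ² − θ))·γ∕2)∕τ` (the rate `ν = 1 + (τ² − θ)∕(τ² + θ) > 1` has `θν ≤ τ²`).  So fading
memory at ANY rate above `√θ` — no E-side smallness; only node N18's `θ < 1`. [folklore] -/
theorem ne9_and_fadingMemory_of_osc_linearSecondDiff_of_lt {γ κ C₀ θ ℓ m τ : ℝ} (hP : PrefixDependenceOn E (Window γ))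
    (hO : ∀ g ∈ Window γ, ∀ g' ∈ Window γ, ∀ (U : Bg) (X : C.Dom) (a : ℕ), a ≤ C.scale X →
      (∀ n, a ≤ n → g n = g' n) → |E g U X - E g' U X| ≤ C₀ * θ ^ (C.scale X - a) * Real.exp (-(κ * C.d X)))
    (hR2 : ∀ g ∈ Window γ, ∀ (U : Bg) (X : C.Dom) (i : ℕ), i < C.scale X → ∀ t d : ℝ, 0 < d →
      t - d ∈ Ioc (0 : ℝ) γ → t + d ∈ Ioc (0 : ℝ) γ →
        |E (Function.update g i (t + d)) U X - 2 * E (Function.update g i t) U X + E (Function.update g i (t - d)) U X| ≤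
          (ℓ + m * ((C.scale X - 1 - i : ℕ) : ℝ)) * Real.exp (-(κ * C.d X)) * d ^ 2)
    (hC₀ : 0 ≤ C₀) (hθ0 : 0 ≤ θ) (hℓ : 0 ≤ ℓ) (hm : 0 ≤ m) (hγ : 0 < γ) (hθτ : θ < τ ^ 2) (hτ0 : 0 < τ) (hτ1 : τ ≤ 1) :
    NE9 E (Window γ) κ (fun k i => (4 * C₀ / γ + (ℓ + m * (τ ^ 2 + θ) / (τ ^ 2 - θ)) * γ / 2) / τ * τ ^ (k - i)) ∧
      FadingMemory ((4 * C₀ / γ + (ℓ + m * (τ ^ 2 + θ) / (τ ^ 2 - θ)) * γ / 2) / τ) τ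
        (fun k i => (4 * C₀ / γ + (ℓ + m * (τ ^ 2 + θ) / (τ ^ 2 - θ)) * γ / 2) / τ * τ ^ (k - i)) := by
  have hsum : 0 < τ ^ 2 + θ := by positivity
  have hdiff : 0 < τ ^ 2 - θ := by linarith
  -- the rate `ν = 1 + (τ² − θ)/(τ² + θ)`
  have hν : 1 < 1 + (τ ^ 2 - θ) / (τ ^ 2 + θ) := by linarith [div_pos hdiff hsum]
  have hθν : θ * (1 + (τ ^ 2 - θ) / (τ ^ 2 + θ)) ≤ τ ^ 2 := by
    rw [mul_add, mul_one, mul_div_assoc', ← le_sub_iff_add_le', div_le_iff₀ hsum]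
    nlinarith
  have h := ne9_and_fadingMemory_of_osc_linearSecondDiff hP hO hR2 hC₀ hθ0 hℓ hm hγ hν hθν hτ0 hτ1
  have e : m / (1 + (τ ^ 2 - θ) / (τ ^ 2 + θ) - 1) = m * (τ ^ 2 + θ) / (τ ^ 2 - θ) := by
    rw [add_sub_cancel_left, div_div_eq_mul_div]
  rw [e] at h
  exact h

/-! ## §3 Along ne9's tower of carriers: node N18 below the level + the linear letter -/

/-- **NODE N22 FOR THE RUN OF LENGTH `k` FROM NODE N18 BELOW `k` + THE LINEAR LETTER.**  On ne9's tower of carriers: `T4OutputRate.NE5` at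
the pairs of run lengths `k′ < k` (node N18 BY NAME, the finite datum; `C₅ ≥ 0`, `0 ≤ θ < 1`), prefix dependence of `E k`, and the linear
second-difference letter (R₂-lin) for `E k` (constants `(ℓ + m·((k − r X) − 1 − i))·e^{−κd(X)}`); for every `ν > 1`, `τ ∈ ]0, 1]` with
`θν ≤ τ²`: `NE9 (C := T.level k) (E k) (Window γ) κ Λ₁ ∧ FadingMemory C₉ τ Λ₁`, `C₉ = (4·(2C₅∕(1−θ))∕γ + (ℓ + m∕(ν−1))·γ∕2)∕τ`. [folklore] -/
theorem ne9_fadingMemory_at_level_of_ne5_below_linear (T : TowerData) {E : ℕ → (ℕ → ℝ) → T.B → T.Dom → ℝ}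
    {γ κ θ C₅ ℓ m ν τ : ℝ} (hC : 0 ≤ C₅) (hθ0 : 0 ≤ θ) (hθ1 : θ < 1) (k : ℕ)
    (h5 : ∀ k' : ℕ, k' < k → ∀ b : ℝ, 0 < b → b ≤ γ →
      NE5 (C := T.level k') (E k') (fun g U X => E (k' + 1) (prepend b g) U X) (Window γ) κ θ C₅)
    (hP : PrefixDependenceOn (C := T.level k) (E k) (Window γ))
    (hR2 : ∀ g ∈ Window γ, ∀ (U : (T.level k).BgA) (X : (T.level k).Dom) (i : ℕ), i < (T.level k).scale X →
      ∀ t d : ℝ, 0 < d → t - d ∈ Ioc (0 : ℝ) γ → t + d ∈ Ioc (0 : ℝ) γ →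
        |E k (Function.update g i (t + d)) U X - 2 * E k (Function.update g i t) U X + E k (Function.update g i (t - d)) U X| ≤
          (ℓ + m * (((T.level k).scale X - 1 - i : ℕ) : ℝ)) * Real.exp (-(κ * (T.level k).d X)) * d ^ 2)
    (hℓ : 0 ≤ ℓ) (hm : 0 ≤ m) (hγ : 0 < γ) (hν : 1 < ν) (hθν : θ * ν ≤ τ ^ 2) (hτ0 : 0 < τ) (hτ1 : τ ≤ 1) :
    NE9 (C := T.level k) (E k) (Window γ) κ
        (fun k i => (4 * (2 * C₅ / (1 - θ)) / γ + (ℓ + m / (ν - 1)) * γ / 2) / τ * τ ^ (k - i)) ∧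
      FadingMemory ((4 * (2 * C₅ / (1 - θ)) / γ + (ℓ + m / (ν - 1)) * γ / 2) / τ) τ
        (fun k i => (4 * (2 * C₅ / (1 - θ)) / γ + (ℓ + m / (ν - 1)) * γ / 2) / τ * τ ^ (k - i)) := by
  have hν0 : 0 < ν := by linarith
  have hM : 0 ≤ ℓ + m / (ν - 1) := add_nonneg hℓ (div_nonneg hm (by linarith))
  have hR2' : ∀ g ∈ Window γ, ∀ (U : (T.level k).BgA) (X : (T.level k).Dom) (i : ℕ), i < (T.level k).scale X →
      ∀ t d : ℝ, 0 < d → t - d ∈ Ioc (0 : ℝ) γ → t + d ∈ Ioc (0 : ℝ) γ →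
        |E k (Function.update g i (t + d)) U X - 2 * E k (Function.update g i t) U X + E k (Function.update g i (t - d)) U X| ≤
          (ℓ + m / (ν - 1)) * ν ^ ((T.level k).scale X - 1 - i) * Real.exp (-(κ * (T.level k).d X)) * d ^ 2 := by
    intro g hg U X i hi t d hd h1 h2
    refine (hR2 g hg U X i hi t d hd h1 h2).trans ?_
    have h := linear_le_geometric hℓ hm hν ((T.level k).scale X - 1 - i)
    have hw : 0 ≤ Real.exp (-(κ * (T.level k).d X)) * d ^ 2 := by positivity
    nlinarith
  have hρ0 : 0 < τ / ν := div_pos hτ0 hν0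
  have hρ1 : τ / ν ≤ 1 := by rw [div_le_one hν0]; linarith
  have hθτρ : θ ≤ τ * (τ / ν) := by
    rw [mul_div_assoc', le_div_iff₀ hν0, ← sq]; exact hθν
  have hμρτ : ν * (τ / ν) ≤ τ := by rw [mul_div_cancel₀ τ hν0.ne']
  exact ne9_fadingMemory_at_level_of_ne5_below T hC hθ0 hθ1 k h5 hP hR2' hM hν0.le hγ hρ0 hρ1 hθτρ hμρτ hτ0

end Abstract

end Summit.QuantumFields.YangMills.BalabanUVNodes.N22KnitLinear

end
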